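import Summits.BirchSwinnertonDyer.BirchSwinnertonDyer.Theorems.SignedLowerHalvesKobayashiLowerHalfSemistableRankCut
import Summits.BirchSwinnertonDyer.BirchSwinnertonDyer.Theses.PrintX6
import Summits.BirchSwinnertonDyer.Rank1Residual.Supersingular.X6RankZeroLeafTarget
import HarnessLib

/-!
# Crux `KobayashiLowerHalfSemistable` (item stmt-BirchSwinnertonDyer-19000), line `birth_musplit`:
# CROSS-ROUTE form of the rank cut — rung K3 (`SignedLowerHalves`, cell bsd-ssimc) closes with the ITEMS OF
# ROUTE `PrintX6` (cell bsd-print-x6) in place of item 19000 (seat `bsd-line-slh-p2`, lead of the line,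
# gen 7; a `--supports … --as helper` file, closes nothing)

HONEST FRAMING (D-0152): pure logic over the two gate-written route files and the landed rank cut
(`…SemistableRankCut.lean`); every hypothesis is a route item BY NAME; both leaves (`SignedSupersingular`,
`WAllCornerX6r0`) and every open item of either route stay OPEN; nothing is booked; BSD is not proved by any
of this. The file imports BOTH route files (`Theses.SignedLowerHalves` via the rank cut, `Theses.PrintX6`
directly) — it is the one place where the two cones meet, by design.

WHAT. Route `PrintX6` (`Summit.BirchSwinnertonDyer.BirchSwinnertonDyer.Theses.PrintX6`) targets the W-ALL row
`Summit.BirchSwinnertonDyer.WAllCornerX6r0` with items `Assembly` (closed, p535696), `PublishedInputsX6`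
(cite-only glue closed), `UpperHalfX6` (closed, p535414), `EisensteinHalfFiveLe` (crux, p ≥ 5; SPLIT: its
erratum-locus child `EisensteinHalfFiveLeErr` is CLOSED modulo the pack `PublishedAcInputsX6Err`, its residual
child `EisensteinHalfFiveLeRest` = the all-split-multiplicative locus is OPEN) and `EisensteinHalfAtThree`
(crux, p = 3, declared residual). By `SemistableRankCut.semistable_rankZero_iff_wAllCornerX6r0` the K3 crux 2
cut to analytic rank `0` IS that row (granted `PublishedSignedInputs`). Hence:

* `signedSupersingular_of_printX6_items_of_lowerHalves` — the rung-K3 leaf from PrintX6's five items BY NAME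
  + K3's items 3, 4, 5, 6 and `PublishedSignedInputs` BY NAME (no item 19000);
* `kobayashiLowerHalfSemistable_rankZero_of_printX6_items` — PrintX6's items ⟹ crux 2 cut to `r_an = 0`;
* `printX6_eisensteinHalves_of_kobayashiLowerHalfSemistable_rankZero` — conversely the cut crux 2 ⟹ both
  Eisenstein cruxes of `PrintX6` (ty2 adapters `X6RankZero.eisensteinHalf{FiveLe,AtThree}_of_forall_…`, granted
  `PublishedSignedInputs`); so, granted the closed items of `PrintX6` and the two published-input bundles,
  «crux 2 cut to `r_an = 0`» ⟺ «`EisensteinHalfFiveLe ∧ EisensteinHalfAtThree`»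
  (`kobayashiLowerHalfSemistable_rankZero_iff_printX6_eisensteinHalves`).

READING FOR THE TWO PENS: inside the cone of `SignedLowerHalves.closes`, item stmt-BirchSwinnertonDyer-19000 and
the pair of PrintX6 cruxes stmt-BirchSwinnertonDyer-20276 (p ≥ 5) ∧ stmt-BirchSwinnertonDyer-20285 (p = 3) are
the SAME obligation; PrintX6's split of 20276 (erratum locus closed modulo its pack, residual = all bad primes
split multiplicative) is therefore also the finest kernel-recorded residual of K3's X6 corner at p ≥ 5.
Calibration only (pen D34-4 (3)): never an input to a stub of line `birth_musplit` or to a by-name close.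

References: [Kobayashi2003] Thm. 1.2, Thm. 4.1, Conjecture (p. 2); [BDKim2013] Cor. 3.15; [Wuthrich2014]
Prop. 21; [Miller2011LMS] Def. 1.1; route files `Theses/SignedLowerHalves.lean` rev 16, `Theses/PrintX6.lean`.
-/

set_option autoImplicit false
-- the Theorems namespace of a single-conjunct summit repeats the summit name by design (D-0017)
set_option linter.dupNamespace false

noncomputable section

open scoped Classical

open WeierstrassCurve Literature.NumberTheory.EllipticCurves
  Literature.NumberTheory.EllipticCurves.Rank1Residual
  Literature.NumberTheory.EllipticCurves.Rank1Residual.Typed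
  Summit.BirchSwinnertonDyer.Rank1Residual.Supersingular
  Summit.BirchSwinnertonDyer.BirchSwinnertonDyer.Theses

namespace Summit.BirchSwinnertonDyer.BirchSwinnertonDyer.Theorems.SemistableRankCutPrintX6

/-- **Rung K3 from the items of route `PrintX6` in place of item 19000.** Granted PrintX6's five items BY
NAME (`Assembly`, `PublishedInputsX6`, `UpperHalfX6` — all three closed on the ledger — and its two Eisenstein
cruxes `EisensteinHalfFiveLe`, `EisensteinHalfAtThree`) and K3's items `KobayashiLowerHalfLargeImage`,
`KobayashiMainConjectureSmallImage`, `SprungLowerHalfAtThree`, `SharpFlatResiduePPart`, `PublishedSignedInputs`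
BY NAME: the rung-K3 leaf `SignedSupersingular`. Proof: `PrintX6.closes` gives `WAllCornerX6r0`, then
`SemistableRankCut.signedSupersingular_of_wAllCornerX6r0_of_lowerHalves`. CONDITIONAL; closes nothing.
[cite: Kobayashi2003, Thm. 1.2, Thm. 4.1 and Conjecture (p. 2)] [cite: Miller2011LMS, Def. 1.1] -/
theorem signedSupersingular_of_printX6_items_of_lowerHalves
    (hAsm6 : PrintX6.Assembly) (hPub6 : PrintX6.PublishedInputsX6) (hU6 : PrintX6.UpperHalfX6)
    (h5 : PrintX6.EisensteinHalfFiveLe) (h3 : PrintX6.EisensteinHalfAtThree)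
    (hB2 : SignedLowerHalves.KobayashiLowerHalfLargeImage)
    (hB2' : SignedLowerHalves.KobayashiMainConjectureSmallImage)
    (hB3 : SignedLowerHalves.SprungLowerHalfAtThree) (hR8 : SignedLowerHalves.SharpFlatResiduePPart)
    (hPub : SignedLowerHalves.PublishedSignedInputs) :
    Summit.BirchSwinnertonDyer.Rank1Residual.Supersingular.SignedSupersingular :=
  SemistableRankCut.signedSupersingular_of_wAllCornerX6r0_of_lowerHalves
    (PrintX6.closes hAsm6 hPub6 hU6 h5 h3) hB2 hB2' hB3 hR8 hPub

/-- **PrintX6's items ⟹ crux 2 cut to analytic rank `0`** (granted K3's `PublishedSignedInputs` for the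
per-pair equivalence `BSDp ↔ ∃ ε, KobayashiLowerDivisibility` at `r_an = 0`). CONDITIONAL; closes nothing.
[cite: Kobayashi2003, Thm. 1.2, Thm. 4.1 and Conjecture (p. 2)] [cite: BDKim2013, Cor. 3.15 (p. 199)]
[cite: Wuthrich2014, Prop. 21 (p. 400)] -/
theorem kobayashiLowerHalfSemistable_rankZero_of_printX6_items
    (hAsm6 : PrintX6.Assembly) (hPub6 : PrintX6.PublishedInputsX6) (hU6 : PrintX6.UpperHalfX6)
    (h5 : PrintX6.EisensteinHalfFiveLe) (h3 : PrintX6.EisensteinHalfAtThree)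
    (hPub : SignedLowerHalves.PublishedSignedInputs) :
    ∀ (W : WeierstrassCurve ℚ) [W.IsElliptic] [W.IsGloballyMinimal] (p : ℕ) [Fact p.Prime],
      p ≠ 2 → ClassX6 W p → W.analyticRank = 0 → ∃ ε : ℤˣ, KobayashiLowerDivisibility W p ε :=
  (SemistableRankCut.semistable_rankZero_iff_wAllCornerX6r0 hPub).mpr (PrintX6.closes hAsm6 hPub6 hU6 h5 h3)

/-- **Conversely, crux 2 cut to analytic rank `0` ⟹ BOTH Eisenstein cruxes of route `PrintX6`**
(`EisensteinHalfFiveLe ∧ EisensteinHalfAtThree`, items stmt-BirchSwinnertonDyer-20276 / -20285), granted K3's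
`PublishedSignedInputs` (Kobayashi Thm. 1.2, Kim Cor. 3.15, modularity, GZK feed the ty2 adapters
`X6RankZero.eisensteinHalf{FiveLe,AtThree}_of_forall_kobayashiLowerDivisibility`, whose descent
`KobayashiLowerDivisibility → ord_p #Ш_an ≤ ord_p #Ш` at `r_an = 0` is the tree road
`missingLowerBoundAt_of_kobayashiLowerDivisibility`). The cut form of `PrintX6BSTWByName`'s road K
(`eisensteinHalves_of_kobayashiLowerHalfSemistable`, which takes the whole crux). CONDITIONAL; closes nothing.
[cite: Kobayashi2003, Thm. 1.2 and Conjecture (p. 2)] [cite: BDKim2013, Cor. 3.15 (p. 199)] [cite: Miller2011LMS, Def. 1.1] -/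
theorem printX6_eisensteinHalves_of_kobayashiLowerHalfSemistable_rankZero
    (hPub : SignedLowerHalves.PublishedSignedInputs)
    (h0 : ∀ (W : WeierstrassCurve ℚ) [W.IsElliptic] [W.IsGloballyMinimal] (p : ℕ) [Fact p.Prime],
      p ≠ 2 → ClassX6 W p → W.analyticRank = 0 → ∃ ε : ℤˣ, KobayashiLowerDivisibility W p ε) :
    PrintX6.EisensteinHalfFiveLe ∧ PrintX6.EisensteinHalfAtThree := by
  unfold SignedLowerHalves.PublishedSignedInputs at hPub
  obtain ⟨-, h12, -, hKim, -, -, -, hmodP, hmod, hGZK⟩ := hPub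
  unfold PrintX6.EisensteinHalfFiveLe PrintX6.EisensteinHalfAtThree
  exact ⟨X6RankZero.eisensteinHalfFiveLe_of_forall_kobayashiLowerDivisibility h12 hKim hmodP hmod hGZK
      (fun W _ _ p _ h5 hX hr0 ↦ h0 W p (by omega) hX hr0),
    X6RankZero.eisensteinHalfAtThree_of_forall_kobayashiLowerDivisibility h12 hKim hmodP hmod hGZK
      (fun W _ _ p _ h3 hX hr0 ↦ h0 W p (by omega) hX hr0)⟩

/-- **Crux 2 cut to analytic rank `0` ⟺ the two Eisenstein cruxes of route `PrintX6`**, granted PrintX6's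
three CLOSED items (`Assembly`, `PublishedInputsX6`, `UpperHalfX6`) and K3's `PublishedSignedInputs`, all by
name. So inside the cone of `SignedLowerHalves.closes` item stmt-BirchSwinnertonDyer-19000 and the pair
stmt-BirchSwinnertonDyer-20276 ∧ stmt-BirchSwinnertonDyer-20285 are ONE obligation. CONDITIONAL; closes nothing.
[cite: Kobayashi2003, Thm. 1.2, Thm. 4.1 and Conjecture (p. 2)] [cite: BDKim2013, Cor. 3.15 (p. 199)]
[cite: Wuthrich2014, Prop. 21 (p. 400)] [cite: Miller2011LMS, Def. 1.1] -/
theorem kobayashiLowerHalfSemistable_rankZero_iff_printX6_eisensteinHalves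
    (hAsm6 : PrintX6.Assembly) (hPub6 : PrintX6.PublishedInputsX6) (hU6 : PrintX6.UpperHalfX6)
    (hPub : SignedLowerHalves.PublishedSignedInputs) :
    (∀ (W : WeierstrassCurve ℚ) [W.IsElliptic] [W.IsGloballyMinimal] (p : ℕ) [Fact p.Prime],
      p ≠ 2 → ClassX6 W p → W.analyticRank = 0 → ∃ ε : ℤˣ, KobayashiLowerDivisibility W p ε) ↔
    (PrintX6.EisensteinHalfFiveLe ∧ PrintX6.EisensteinHalfAtThree) :=
  ⟨printX6_eisensteinHalves_of_kobayashiLowerHalfSemistable_rankZero hPub,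
    fun h ↦ kobayashiLowerHalfSemistable_rankZero_of_printX6_items hAsm6 hPub6 hU6 h.1 h.2 hPub⟩

/-- **The K3 crux 2 by name ⟹ both Eisenstein cruxes of `PrintX6`** (granted `PublishedSignedInputs`; the whole
crux restricted to `r_an = 0` via `SemistableRankCut.kobayashiLowerHalfSemistable_rankZero_of_crux`). Same content
as `PrintX6BSTWByName.eisensteinHalves_of_kobayashiLowerHalfSemistable` up to the published bundle used
(there `PrintX6.PublishedInputsX6`, here K3's `PublishedSignedInputs`). CONDITIONAL; closes nothing.
[cite: Kobayashi2003, Thm. 1.2 and Conjecture (p. 2)] [cite: BDKim2013, Cor. 3.15 (p. 199)] -/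
theorem printX6_eisensteinHalves_of_kobayashiLowerHalfSemistable
    (hPub : SignedLowerHalves.PublishedSignedInputs) (h : SignedLowerHalves.KobayashiLowerHalfSemistable) :
    PrintX6.EisensteinHalfFiveLe ∧ PrintX6.EisensteinHalfAtThree :=
  printX6_eisensteinHalves_of_kobayashiLowerHalfSemistable_rankZero hPub
    (SemistableRankCut.kobayashiLowerHalfSemistable_rankZero_of_crux h)

end Summit.BirchSwinnertonDyer.BirchSwinnertonDyer.Theorems.SemistableRankCutPrintX6

end
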